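import Literature.MathematicalPhysics.QuantumFieldTheory.Balaban1983to89.B9Thm39CinvTorusRegularFinal
import Literature.MathematicalPhysics.QuantumFieldTheory.Balaban1983to89.B9Thm39CinvUpperL
import Literature.MathematicalPhysics.QuantumFieldTheory.Balaban1983to89.B9B8KnitLetterRBound

/-!
# `Balaban1983to89.B9B8KnitLetterCinvFromM56` — MODULE M5.6 AT THE KNIT LETTER: [B9] Theorem 3.9 ⇒ Theorem 3.2 (3.48) for
# `C(U) = (Q′G′²Q′*)⁻¹(U; parKnitY)` — p21's `B9Thm39CinvTorusRegularFinal.hasMajorant_conj_XinvY_final` at `parS := parKnitY`, with the invertibility of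
# `Q′G′²Q′*` (junction file 13), the contractive transporters (junction file 17) and the site majorants of `η⁴G′²`, `η⁴G′_□²` (from (3.42)₁-shape site majorants,
# junction file 15's output shape, by M5.6 FILE 3a) DISCHARGED; the supplier of the displayed `(3.48)`-shape hypothesis `hC` of junction files 17–19, and
# the consumer's (E15) at print's transporters from Theorem-3.1-type data end to end (junction J-B file 20)

statement-level skeleton of published theorems with citation tags; proofs where landed; nothing here is a claim about the
Yang–Mills mass gap

T. Bałaban, *Propagators for lattice gauge theories in a background field*, Commun. Math. Phys. **99** (1985) 389–434 [`Balaban1985BackgroundPropagators`,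
"[B9]"]; T. Bałaban, *Propagators and renormalization transformations for lattice gauge theories. II*, Commun. Math. Phys. **96** (1984) 223–250
[`Balaban1984PropagatorsII`, "[4]"]; T. Bałaban, *Spaces of regular gauge field configurations on a lattice and gauge fixing conditions*, Commun. Math.
Phys. **99** (1985) 75–102 [`Balaban1985RegularSpaces`, "[B8]"].

THE PRINT.  [B9] p. 398 Theorem 3.2 (3.48) «|(Q′(U)G′²(U)Q′*(U))⁻¹(y, y′)| ≦ B₀(Lʲη)⁻⁴(L^{j′}η)^{−d}e^{−δ₀d(y,y′)}»; p. 409 (3.87) «C₀ = Σ_{□∈𝒟} h_□C_□h_□»,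
«C_□(U) = (Q′(U)G′²_□(U)Q′*(U))⁻¹»; p. 411 (3.95)–(3.96) «(Q′G′²Q′*)⁻¹ = C₀(I − R)⁻¹ = Σ C₀Rⁿ»; p. 413 Theorem 3.9 «For M sufficiently large … This theorem
implies Theorem 3.2»; p. 393 (3.19) with «(52), (53) in [5]» (the knit letter); p. 395 «positivity of the operators G′, Q′G′²Q′*, hence the existence of the
operator R».  [4] (2.83) p. 237 «O(1)(Lʲη)⁴e^{−½δ₀d(y,y″)}» (the factor `Q′G′²Q′*`), Lemma 2.1 (2.61) p. 234, (2.52) p. 232.  [B8] (1.96)–(1.98) p. 92 (the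
consumer's letter `C` and (E15)).

WHY THIS FILE ∕ THE ARGUMENT.  M5.6's assembly `hasMajorant_conj_XinvY_final` is letter-generic (`parS`, `Gp`): at `parS := parKnitY`, `Gp := G′(·; parKnitY)` its
three non-analytic inputs are theorems of the junction — `IsUnit (Q′G′²Q′*)(U; parKnitY)` (junction file 13 `isUnit_XY_parKnitY`, p. 395), contractive knit legs
(file 17 `parKnitY_contractive`), and the SITE majorants `hGG`, `hGGc` of `η⁴G′²`, `η⁴G′_□²`, which M5.6 FILE 3a's `hasMajorant_conj_mul_weighted` ([4] (2.83))
produces from (3.42)₁-shape site majorants `A·ℓ²·e^{−δ_Gd}` of `η²G′(U; parKnitY)` (junction file 15's OUTPUT shape) and of the cube letters `η²G′_□(U)`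
(M5.2-E's, support indicator dropped).  Everything else — the cube cover's cut-offs, the per-cube (3.48) blocks `hC` of the `C_□`, the local inverse property,
the [2]-difference majorants `hD` (GAP G-B9-05), slow variation, separation, geometry, located smallness — stays displayed VERBATIM as in M5.6 FILE 8.  The
output is EXACTLY the displayed hypothesis `hC` of junction files 17–19 (`K = N B₀c₁(1 − θc₁)⁻¹`, rate `(1−α′)ρδ₀`), so §3 composes it with file 17's
`knit_E15_constLev`: (E15) at print's transporters from Theorem-3.1-type site majorants and M5.6's per-cube data, end to end.

CITATION HEADER (lean-in-tree rule).  Cell `lit-balaban`, sub-row G-B9-LETTERS, junction J-B file 20 → seat `lit-balaban-p33` gen 95.  REUSED BY NAME: p21 M5.6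
`B9Thm39CinvTorusRegularFinal.hasMajorant_conj_XinvY_final` (FILE 6), `B9Thm39CinvUpperL.hasMajorant_conj_mul_weighted` (FILE 3a), `B9Thm37CubeCoverCommutators.cutMulY`;
junction files 13 (`isUnit_XY_parKnitY`), 17 (`parKnitY_contractive`, `knit_E15_constLev`); def-Y `Node00.{XY, XinvY, GpY, RY}`; J-B 2 `parKnitY`.

WHAT THIS FILE PROVES (sorry-free; no definitions; nothing of [B9]'s analysis asserted).
* §1 ★ `hasMajorant_conj_GG_of_hasMajorant` — `conj b(η²T) ≺ A·ℓ²·e^{−δ_Gd}` ⟹ `conj b((η²η²)·(T·T)) ≺ (A²Cc₁((1−α_G)δ_G,α₂))·((ℓ⁴)⁻¹)⁻¹·e^{−a_Lδ₀d}` for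
  `a_Lδ₀ ≦ (1−α₂)(1−α_G)δ_G` ([4] (2.83) with the scale transfer of `ℓ²`).
* §2 ★★★ **`hasMajorant_conj_XinvY_parKnitY_of_site`** — THEOREM 3.9 ⇒ (3.48)-shape majorant of `conj b(s·(Q′G′²Q′*)⁻¹(U; parKnitY))`:
  `N·B₀·c₁(ρδ₀,α′)(1 − (θ₁+θ₂+θ₃)c₁)⁻¹·ℓ(a)⁻⁴·e^{−(1−α′)ρδ₀d}` on the block carrier, for `G ≤ U(N)` (`N ≥ 1`), a `G`-valued `U` with `G`-valued knit legs, from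
  the two (3.42)₁-shape site majorants and M5.6's displayed per-cube data (`κ_G := A²C_Gc₁`).
* §3 ★★★ **`knit_E15_constLev_of_site`** — the consumer's (E15) `(Lⁿη′)²‖(R(U)Λ)(z)‖ ≦ B_R·r` at the knit letter on a constant-level member from the same data
  plus (2.61) at `β` and a row sum for the rate `(1−α′)ρδ₀` (junction file 17 ∘ §2; `(1−α′)ρδ₀ ≦ δ_G`).

HONEST SCOPE.  Composition (plumbing) of landed theorems; exactly M5.6's scope at the knit letter: the site majorants of `η²G′(U; parKnitY)` (junction file
15 from M5.5's cube data) and of the cube letters, the per-cube `hC` ∕ `hloc` (M5.2-E), `hD` (GAP G-B9-05 — NOT derived in the tree), `hLip` (G-pv08-1), the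
cover's separation ∕ overlap, the geometry and the smallness («M sufficiently large») are DISPLAYED hypotheses of the printed shapes; sup-entry (3.48) only.
Count-neutral; nothing continuum, nothing about OS axioms or the mass gap.  No `sorry`, no `axiom`, no `instance`, no `notation`.  NEW file; nothing landed is
modified.  Net new unproved facts: 0.  Seat `lit-balaban-p33` gen 95, 2026-08-28.
-/

noncomputable section

namespace Literature.MathematicalPhysics.QuantumFieldTheory.Balaban1983to89.B9B8KnitLetterCinvFromM56

open Node00 B6KLevelCensusIndexV1 B6Geom246MultiLevelBox B9BackgroundsKLevelV1
open B6RandomWalk (HasMajorant Triangle254 Ineq261 Ineq263 hasMajorant_mono c1_nonneg)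
open B6Ineq2142KLevelV1 (β)
open B9Thm34Ext (toB6)
open B9GeoNormsKLevelV1 (geo9K geo9K_len_kGeo)
open B9Eq352DivFormLetters (conj)
open B9Thm37CubeCoverCommutators (cutMulY)
open B9Thm39CinvTorusRegularFinal (hasMajorant_conj_XinvY_final)
open B9Thm39CinvUpperL (hasMajorant_conj_mul_weighted)
open B9Ineq349SiteComposite (etaS_pos)
open B9B8AveragingJunction (parKnitY)
open B9B8KnitLetterProjectionC (isUnit_XY_parKnitY)
open B9B8KnitLetterRBound (parKnitY_contractive knit_E15_constLev)
open scoped Matrix Matrix.Norms.L2Operator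

variable {d ℓ : ℕ} {hd : 1 ≤ d + 1} {hL : Odd (ℓ + 1) ∧ 1 < ℓ + 1} {b₀ b₁ : ℝ}
variable (i : KIdx d ℓ hd hL b₀ b₁)

/-! ## §1 The site majorant of `η⁴T²` from a (3.42)₁-shape site majorant of `η²T` ([4] (2.83), scale transfer of `ℓ²`) -/

section GG

variable {𝔸 : Type} [NormedRing 𝔸] [NormedAlgebra ℂ 𝔸] [CompleteSpace 𝔸]
variable {ι : Type} [Fintype ι] (b : Module.Basis ι ℝ 𝔸)
variable [Fintype (geo9K i).Site] {Rr : ℝ} {Hp : Prop} (ιB : BlkY i → IBondY i)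

omit [CompleteSpace 𝔸] in
/-- ★ **`conj b((η²η²)·(T·T)) ≺ (A²Cc₁)·((ℓ⁴)⁻¹)⁻¹·e^{−a_Lδ₀d}` FROM `conj b(η²T) ≺ A·ℓ²·e^{−δ_Gd}`** ([4] (2.83) «O(1)(Lʲη)⁴e^{−½δ₀d(y,y″)}» with O(1) and the rate
explicit; M5.6 FILE 3a with the scale transfer of `ℓ²` at `α_G` (constant `C_G`), (2.61) at `((1−α_G)δ_G, α₂)`, any target rate `a_Lδ₀ ≦ (1−α₂)(1−α_G)δ_G`) —
the shape of M5.6 FILE 6's `hGG` at `P = ℓ⁻⁴`. [cite: Balaban1984PropagatorsII, (2.83) p.237, (2.52) p.232, (2.61) p.234; Balaban1985BackgroundPropagators, Thm 3.1 (3.42) p.397, (3.95) p.411, p.398 (scale transfer)] -/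
theorem hasMajorant_conj_GG_of_hasMajorant (T : Module.End ℝ (SiteY i → 𝔸)) {A δG : ℝ} (hA : 0 ≤ A)
    (hT : HasMajorant (g := toB6 (geo9K i) Rr Hp) (fun p : SiteY i × ι => ιB (blkOf i.D.toDomains p.1)) (conj b ((etaS i ^ 2) • T))
      (fun a a' => A * (geo9K i).len a ^ 2 * Real.exp (-(δG * (geo9K i).dist a a'))))
    (d₂ : ℕ) {αG α₂ CG aL δ₀ : ℝ} (hCG : 0 ≤ CG) (hαGδ : 0 ≤ αG * δG) (hα₂0 : 0 ≤ α₂) (hα₂1 : α₂ ≤ 1) (hδG : 0 ≤ (1 - αG) * δG)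
    (htri : Triangle254 (toB6 (geo9K i) Rr Hp)) (hdnn : ∀ a a' : (geo9K i).Site, 0 ≤ (geo9K i).dist a a')
    (hSTG : B9Ineq347.ScaleTransfer (geo9K i) δG αG CG (fun a => (geo9K i).len a ^ 2))
    (h261G : Ineq261 d₂ (toB6 (geo9K i) Rr Hp) ((1 - αG) * δG) α₂) (hrate : aL * δ₀ ≤ (1 - α₂) * ((1 - αG) * δG)) :
    HasMajorant (g := toB6 (geo9K i) Rr Hp) (fun p : SiteY i × ι => ιB (blkOf i.D.toDomains p.1))
      (conj b ((etaS i ^ 2 * etaS i ^ 2) • (T * T)))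
      (fun a a'' => (A ^ 2 * CG * B6.c1 d₂ ((1 - αG) * δG) α₂) * (((geo9K i).len a ^ 4)⁻¹)⁻¹ * Real.exp (-(aL * δ₀ * (geo9K i).dist a a''))) := by
  have hGG := hasMajorant_conj_mul_weighted b (g := geo9K i) (R := Rr) (H := Hp) (fun p : SiteY i × ι => ιB (blkOf i.D.toDomains p.1)) d₂
    (fun a => (geo9K i).len a ^ 2) (fun a => (geo9K i).len a ^ 2) (etaS i ^ 2) (etaS i ^ 2) (B₁ := A) (B₂ := A) hA hA hCG (fun a => sq_nonneg _)
    (fun a => sq_nonneg _) hαGδ hα₂0 hα₂1 hδG htri hdnn hSTG h261G hT hT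
  refine hasMajorant_mono (g := toB6 (geo9K i) Rr Hp) _ hGG fun a a'' => ?_
  have hpre : 0 ≤ A ^ 2 * CG * B6.c1 d₂ ((1 - αG) * δG) α₂ * (((geo9K i).len a ^ 4)⁻¹)⁻¹ := by
    rw [inv_inv]
    exact mul_nonneg (mul_nonneg (mul_nonneg (sq_nonneg _) hCG) (c1_nonneg d₂ _ _)) (pow_nonneg (by rw [geo9K_len_kGeo]; exact (len_pos i a).le) 4)
  have hexp : Real.exp (-((1 - α₂) * ((1 - αG) * δG) * (geo9K i).dist a a'')) ≤ Real.exp (-(aL * δ₀ * (geo9K i).dist a a'')) := by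
    refine Real.exp_le_exp.mpr ?_
    have h1 := mul_le_mul_of_nonneg_right hrate (hdnn a a'')
    linarith
  calc A * A * CG * B6.c1 d₂ ((1 - αG) * δG) α₂ * ((geo9K i).len a ^ 2 * (geo9K i).len a ^ 2) *
        Real.exp (-((1 - α₂) * ((1 - αG) * δG) * (geo9K i).dist a a''))
      = A ^ 2 * CG * B6.c1 d₂ ((1 - αG) * δG) α₂ * (((geo9K i).len a ^ 4)⁻¹)⁻¹ *
          Real.exp (-((1 - α₂) * ((1 - αG) * δG) * (geo9K i).dist a a'')) := by rw [inv_inv]; ring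
    _ ≤ _ := mul_le_mul_of_nonneg_left hexp hpre

end GG

/-! ## §2 ★★★ M5.6 FILE 6 at `parS := parKnitY`: the (3.48)-shape majorant of `conj b(s·(Q′G′²Q′*)⁻¹(U; parKnitY))` -/

section Knit

variable {N : ℕ} {G : Subgroup (Matrix (Fin N) (Fin N) ℂ)ˣ}
variable {ι : Type} [Fintype ι] [DecidableEq ι] (b : Module.Basis ι ℝ (Matrix (Fin N) (Fin N) ℂ))
variable [Fintype (geo9K i).Site] [DecidableEq (geo9K i).Site] {Rr : ℝ} {Hp : Prop} (ιB : BlkY i → IBondY i)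

/-- ★★★ **THEOREM 3.9 ⇒ THEOREM 3.2's (3.48)-SHAPE MAJORANT FOR `C(U) = (Q′G′²Q′*)⁻¹(U; parKnitY)` AT PRINT's TRANSPORTERS** — M5.6 FILE 6 at `parS := parKnitY`,
`Gp := G′(·; parKnitY)`: for `G ≤ U(N)` (`N ≥ 1`), a `G`-valued `U` with `G`-valued knit legs (so `Q′G′²Q′*` is a unit and the transporters are contractions), a
real basis `b` (coordinate bound `M₂`); the (3.42)₁-shape SITE majorants `A·ℓ²·e^{−δ_Gd}` of `conj b(η²G′(U; parKnitY))` (junction file 15's output shape) and of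
every cube letter `conj b(η²G′_□(U))`, the scale transfer of `ℓ²` at `α_G` and (2.61) at `((1−α_G)δ_G, α₂)`, a target rate `a_Lδ₀ ≦ (1−α₂)(1−α_G)δ_G`; and
M5.6's per-cube data VERBATIM at `P = ℓ⁻⁴`, `s′ = η²η²` (cut-offs `h_□`, `χ_□`, supports, overlap `N`, separation `D_sep`, slow variation, local inverse
property `hloc`, per-cube (3.48) blocks `hC` of `C_□ = Cl □`, [2]-difference majorants `hD` (GAP G-B9-05, weight `ℓ⁴`), scale transfer of `ℓ⁻⁴` at `α_st`,
(2.54), reflexivity ∕ symmetry ∕ `d ≧ 0`, Lemma 2.1 at `(δ₀, b−ρ)` and at `(ρδ₀, α′)`, exponent splits, located smallness with `κ_G := A²C_Gc₁`) ⟹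
`conj b(s·(Q′G′²Q′*)⁻¹(U; parKnitY)) ≺ N·B₀·c₁(ρδ₀,α′)·(1 − (θ₁+θ₂+θ₃)c₁(ρδ₀,α′))⁻¹·ℓ(a)⁻⁴·e^{−(1−α′)ρδ₀d}` on the block carrier — EXACTLY the displayed `hC` of
junction files 17–19. [cite: Balaban1985BackgroundPropagators, Thm 3.9 p.413, (3.95)–(3.96) p.411, (3.87) p.409, Thm 3.2 (3.48) p.398, Thm 3.1 (3.42) p.397, p.395, (3.19) p.393; Balaban1984PropagatorsII, Lemma 2.1 p.234, (2.83)–(2.85) p.237] -/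
theorem hasMajorant_conj_XinvY_parKnitY_of_site [Nonempty (Fin N)] (hG : G ≤ B7Prop2Explicit.unitaryUnits (Matrix (Fin N) (Fin N) ℂ))
    {U : CfgY (Matrix (Fin N) (Fin N) ℂ) i} (hU : ∀ μ x, U μ x ∈ G) (hpar : ∀ z w : SiteY i, parKnitY i U z w ∈ G)
    {κι : Type} [Fintype κι] (Oc : κι → SiteOpY (Matrix (Fin N) (Fin N) ℂ) i)
    {M₂ : ℝ} (hM₂ : 0 ≤ M₂) (hrepr : ∀ (v : Matrix (Fin N) (Fin N) ℂ) (j : ι), |b.repr v j| ≤ M₂ * ‖v‖) (d' d₂ : ℕ)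
    {A δG αG α₂ CG : ℝ} (hA : 0 ≤ A) (hCG : 0 ≤ CG) (hαGδ : 0 ≤ αG * δG) (hα₂0 : 0 ≤ α₂) (hα₂1 : α₂ ≤ 1) (hδG : 0 ≤ (1 - αG) * δG)
    (hSTG : B9Ineq347.ScaleTransfer (geo9K i) δG αG CG (fun a => (geo9K i).len a ^ 2))
    (h261G : Ineq261 d₂ (toB6 (geo9K i) Rr Hp) ((1 - αG) * δG) α₂)
    (hGm : HasMajorant (g := toB6 (geo9K i) Rr Hp) (fun p : SiteY i × ι => ιB (blkOf i.D.toDomains p.1))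
      (conj b ((etaS i ^ 2) • (GpY i (parKnitY i) U).restrictScalars ℝ)) (fun a a' => A * (geo9K i).len a ^ 2 * Real.exp (-(δG * (geo9K i).dist a a'))))
    (hGc : ∀ k, HasMajorant (g := toB6 (geo9K i) Rr Hp) (fun p : SiteY i × ι => ιB (blkOf i.D.toDomains p.1))
      (conj b ((etaS i ^ 2) • (Oc k U).restrictScalars ℝ)) (fun a a' => A * (geo9K i).len a ^ 2 * Real.exp (-(δG * (geo9K i).dist a a'))))
    {δ₀ aL aD αc αst asep ρ bb κG κD Dsep ℓ₀ ℓ₁ B₀ C Nn s α' θ₁ θ₂ θ₃ : ℝ} (hrate : aL * δ₀ ≤ (1 - α₂) * ((1 - αG) * δG))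
    (Sχ S : κι → Finset (geo9K i).Site) (χ h : κι → BlkY i → ℝ) (Cl : κι → Module.End ℝ (BlkY i → Matrix (Fin N) (Fin N) ℂ))
    (hs : (etaS i ^ 2 * etaS i ^ 2) * s = 1) (hκD : 0 ≤ κD) (hℓ₀ : 0 ≤ ℓ₀) (hℓ₁ : 0 ≤ ℓ₁) (hB₀ : 0 ≤ B₀) (hC0 : 0 ≤ C) (hN : 0 ≤ Nn)
    (hδ₀ : 0 ≤ δ₀) (hasep : 0 ≤ asep) (hρ : 0 ≤ ρ) (hρb : ρ ≤ bb) (hαc : 0 < αc * δ₀) (hα'1 : α' ≤ 1)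
    (hsplit₁ : αst + asep + ρ ≤ aL) (hsplit₂ : αst + ρ ≤ aD) (hsplit₃ : αst + αc + ρ ≤ aL)
    (hκG : κG = A ^ 2 * CG * B6.c1 d₂ ((1 - αG) * δG) α₂)
    (hθ₁ : θ₁ = Nn * (((M₂ * ∑ j, ‖b j‖) ^ 2 * κG) * B₀ * C * B6.c1 d' δ₀ (bb - ρ) * Real.exp (-(asep * δ₀ * Dsep))))
    (hθ₂ : θ₂ = Nn * (κD * Real.exp (-(2 * δ₀ * Dsep)) * B₀ * C * B6.c1 d' δ₀ (bb - ρ)))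
    (hθ₃ : θ₃ = Nn * ((ℓ₀ + ℓ₁ * (αc * δ₀)⁻¹) * ((M₂ * ∑ j, ‖b j‖) ^ 2 * κG) * B₀ * C * B6.c1 d' δ₀ (bb - ρ)))
    (htri : Triangle254 (toB6 (geo9K i) Rr Hp)) (hrefl : ∀ y : (geo9K i).Site, (geo9K i).dist y y = 0)
    (hsymm : ∀ a a' : (geo9K i).Site, (geo9K i).dist a a' = (geo9K i).dist a' a) (hdnn : ∀ a a' : (geo9K i).Site, 0 ≤ (geo9K i).dist a a')
    (hST : B9Ineq347.ScaleTransfer (geo9K i) δ₀ αst C (fun a => ((geo9K i).len a ^ 4)⁻¹)) (h261b : Ineq261 d' (toB6 (geo9K i) Rr Hp) δ₀ (bb - ρ))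
    (h261 : Ineq261 d' (toB6 (geo9K i) Rr Hp) (ρ * δ₀) α') (h263 : Ineq263 d' (toB6 (geo9K i) Rr Hp) (ρ * δ₀) α')
    (hsmall : (θ₁ + θ₂ + θ₃) * B6.c1 d' (ρ * δ₀) α' < 1)
    (hsq : ∀ t, ∑ k, h k t ^ 2 = 1) (hh : ∀ k t, |h k t| ≤ 1) (hS : ∀ k t, h k t ≠ 0 → ιB t ∈ S k)
    (hcnt : ∀ a : (geo9K i).Site, (∑ k, if a ∈ S k then (1 : ℝ) else 0) ≤ Nn)
    (hχ01 : ∀ k t, 0 ≤ χ k t ∧ χ k t ≤ 1) (hχS : ∀ k t, ιB t ∈ Sχ k → χ k t = 1)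
    (hsep : ∀ k a, a ∉ Sχ k → ∀ a'' ∈ S k, Dsep ≤ (geo9K i).dist a a'')
    (hLip : ∀ k (t t' : BlkY i), |h k t' - h k t| ≤ ℓ₀ + ℓ₁ * (geo9K i).dist (ιB t) (ιB t'))
    (hloc : ∀ k, (cutMulY (𝔸 := Matrix (Fin N) (Fin N) ℂ) (h k)).restrictScalars ℝ *
      ((cutMulY (𝔸 := Matrix (Fin N) (Fin N) ℂ) (χ k)).restrictScalars ℝ * (XY i (parKnitY i) (Oc k) U).restrictScalars ℝ) * Cl k *
        (cutMulY (𝔸 := Matrix (Fin N) (Fin N) ℂ) (h k)).restrictScalars ℝ =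
      (cutMulY (𝔸 := Matrix (Fin N) (Fin N) ℂ) (h k)).restrictScalars ℝ * (cutMulY (𝔸 := Matrix (Fin N) (Fin N) ℂ) (h k)).restrictScalars ℝ)
    (hC : ∀ k, HasMajorant (g := toB6 (geo9K i) Rr Hp) (fun p : BlkY i × ι => ιB p.1) (conj b (s • Cl k))
      (fun a a' => if a ∈ S k then B₀ * ((geo9K i).len a ^ 4)⁻¹ * Real.exp (-(bb * δ₀ * (geo9K i).dist a a')) else 0))
    (hD : ∀ k, HasMajorant (g := toB6 (geo9K i) Rr Hp) (fun p : BlkY i × ι => ιB p.1)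
      (conj b ((etaS i ^ 2 * etaS i ^ 2) • ((XY i (parKnitY i) (GpY i (parKnitY i)) U).restrictScalars ℝ - (XY i (parKnitY i) (Oc k) U).restrictScalars ℝ)))
      (fun a a'' => κD * Real.exp (-(2 * δ₀ * Dsep)) * (geo9K i).len a ^ 4 * Real.exp (-(aD * δ₀ * (geo9K i).dist a a'')))) :
    HasMajorant (g := toB6 (geo9K i) Rr Hp) (fun p : BlkY i × ι => ιB p.1)
      (conj b (s • (XinvY i (parKnitY i) (GpY i (parKnitY i)) U).restrictScalars ℝ))
      (fun a a' => Nn * B₀ * B6.c1 d' (ρ * δ₀) α' * (1 - (θ₁ + θ₂ + θ₃) * B6.c1 d' (ρ * δ₀) α')⁻¹ * ((geo9K i).len a ^ 4)⁻¹ *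
        Real.exp (-((1 - α') * (ρ * δ₀) * (geo9K i).dist a a'))) := by
  subst hκG
  have hP : ∀ a : (geo9K i).Site, 0 < ((geo9K i).len a ^ 4)⁻¹ := fun a =>
    inv_pos.mpr (pow_pos (by rw [geo9K_len_kGeo]; exact len_pos i a) 4)
  -- the [2]-difference majorants at FILE 6's weight `(P a)⁻¹ = ((ℓ⁴)⁻¹)⁻¹`
  have hD' : ∀ k, HasMajorant (g := toB6 (geo9K i) Rr Hp) (fun p : BlkY i × ι => ιB p.1)
      (conj b ((etaS i ^ 2 * etaS i ^ 2) • ((XY i (parKnitY i) (GpY i (parKnitY i)) U).restrictScalars ℝ - (XY i (parKnitY i) (Oc k) U).restrictScalars ℝ)))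
      (fun a a'' => κD * Real.exp (-(2 * δ₀ * Dsep)) * (((geo9K i).len a ^ 4)⁻¹)⁻¹ * Real.exp (-(aD * δ₀ * (geo9K i).dist a a''))) := fun k =>
    hasMajorant_mono (g := toB6 (geo9K i) Rr Hp) _ (hD k) fun a a'' => le_of_eq (by rw [inv_inv])
  -- FILE 6 at `parKnitY`, fed with §1's site majorants of `η⁴G′²` and `η⁴G′_□²`
  exact hasMajorant_conj_XinvY_final i b ιB (parKnitY i) (GpY i (parKnitY i)) U (isUnit_XY_parKnitY i hG hU hpar) (parKnitY_contractive i hG hpar) hM₂ hrepr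
    d' (fun a => ((geo9K i).len a ^ 4)⁻¹) Sχ S χ h Oc Cl hs (mul_nonneg (mul_nonneg (sq_nonneg _) hCG) (c1_nonneg d₂ _ _)) hκD hℓ₀ hℓ₁ hB₀ hC0 hN hP hδ₀
    hasep hρ hρb hαc hα'1 hsplit₁ hsplit₂ hsplit₃ hθ₁ hθ₂ hθ₃ htri hrefl hsymm hdnn hST h261b h261 h263 hsmall hsq hh hS hcnt hχ01 hχS hsep hLip hloc hC
    (hasMajorant_conj_GG_of_hasMajorant i b ιB _ hA hGm d₂ hCG hαGδ hα₂0 hα₂1 hδG htri hdnn hSTG h261G hrate)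
    (fun k => hasMajorant_conj_GG_of_hasMajorant i b ιB _ hA (hGc k) d₂ hCG hαGδ hα₂0 hα₂1 hδG htri hdnn hSTG h261G hrate) hD'

/-! ## §3 ★★★ (E15) at the knit letter from Theorem-3.1-type site majorants and M5.6's per-cube data, end to end -/

/-- ★★★ **(E15) `r_bound` OF `B8Thm2TorusLetters.LettersAt` AT THE KNIT LETTER FROM THEOREM-3.1-TYPE DATA, END TO END** (junction file 17's `knit_E15_constLev` ∘
§2): on a constant-level-`n` member, for `G ≤ U(N)` (`N ≥ 1`), a `G`-valued `U` with `G`-valued knit legs, under the hypotheses of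
`hasMajorant_conj_XinvY_parKnitY_of_site` and, for the word of (3.49): the rate bookkeeping `(1−α′)ρδ₀ ≦ δ_G`, (2.61) at `(ε₀, β)` with `ρ₃ + βε₀ ≦ (1−α′)ρδ₀`,
a row-sum constant `c₃` at `ρ₃`; then for `η′ ≠ 0` and every `Λ` with `(Lⁿη′)²‖Λ(w)‖ ≦ r`:
`(Lⁿη′)²‖(R(U)Λ)(z)‖ ≦ (1 + (Σ‖b_j‖)·(M₂Σ‖b_j‖)²·A·K·A·c₁(ε₀,β)²·c₃·M₂)·r`, `K = N B₀c₁(ρδ₀,α′)(1 − (θ₁+θ₂+θ₃)c₁)⁻¹` — [B8] (1.98) at print's transporters with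
NO displayed (3.48) majorant left. [cite: Balaban1985RegularSpaces, (1.98) p.92, p.77 («Ω_j = T_η»); Balaban1985BackgroundPropagators, (3.25) p.394, (3.49) p.399, Thm 3.1 (3.42) p.397, Thm 3.2 (3.48) p.398, Thm 3.9 p.413; Balaban1984PropagatorsII, (2.61) p.234] -/
theorem knit_E15_constLev_of_site [Nonempty (Fin N)] {n : ℕ} (hlev : ∀ z : SiteY i, levY i z = n)
    (hG : G ≤ B7Prop2Explicit.unitaryUnits (Matrix (Fin N) (Fin N) ℂ))
    {U : CfgY (Matrix (Fin N) (Fin N) ℂ) i} (hU : ∀ μ x, U μ x ∈ G) (hpar : ∀ z w : SiteY i, parKnitY i U z w ∈ G)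
    {κι : Type} [Fintype κι] (Oc : κι → SiteOpY (Matrix (Fin N) (Fin N) ℂ) i)
    {M₂ : ℝ} (hM₂ : 0 ≤ M₂) (hrepr : ∀ (v : Matrix (Fin N) (Fin N) ℂ) (j : ι), |b.repr v j| ≤ M₂ * ‖v‖) (d' d₂ : ℕ)
    {A δG αG α₂ CG : ℝ} (hA : 0 ≤ A) (hCG : 0 ≤ CG) (hαGδ : 0 ≤ αG * δG) (hα₂0 : 0 ≤ α₂) (hα₂1 : α₂ ≤ 1) (hδG : 0 ≤ (1 - αG) * δG)
    (hSTG : B9Ineq347.ScaleTransfer (geo9K i) δG αG CG (fun a => (geo9K i).len a ^ 2))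
    (h261G : Ineq261 d₂ (toB6 (geo9K i) Rr Hp) ((1 - αG) * δG) α₂)
    (hGm : HasMajorant (g := toB6 (geo9K i) Rr Hp) (fun p : SiteY i × ι => ιB (blkOf i.D.toDomains p.1))
      (conj b ((etaS i ^ 2) • (GpY i (parKnitY i) U).restrictScalars ℝ)) (fun a a' => A * (geo9K i).len a ^ 2 * Real.exp (-(δG * (geo9K i).dist a a'))))
    (hGc : ∀ k, HasMajorant (g := toB6 (geo9K i) Rr Hp) (fun p : SiteY i × ι => ιB (blkOf i.D.toDomains p.1))
      (conj b ((etaS i ^ 2) • (Oc k U).restrictScalars ℝ)) (fun a a' => A * (geo9K i).len a ^ 2 * Real.exp (-(δG * (geo9K i).dist a a'))))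
    {δ₀ aL aD αc αst asep ρ bb κG κD Dsep ℓ₀ ℓ₁ B₀ C Nn s α' θ₁ θ₂ θ₃ : ℝ} (hrate : aL * δ₀ ≤ (1 - α₂) * ((1 - αG) * δG))
    (Sχ S : κι → Finset (geo9K i).Site) (χ h : κι → BlkY i → ℝ) (Cl : κι → Module.End ℝ (BlkY i → Matrix (Fin N) (Fin N) ℂ))
    (hs : (etaS i ^ 2 * etaS i ^ 2) * s = 1) (hκD : 0 ≤ κD) (hℓ₀ : 0 ≤ ℓ₀) (hℓ₁ : 0 ≤ ℓ₁) (hB₀ : 0 ≤ B₀) (hC0 : 0 ≤ C) (hN : 0 ≤ Nn)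
    (hδ₀ : 0 ≤ δ₀) (hasep : 0 ≤ asep) (hρ : 0 ≤ ρ) (hρb : ρ ≤ bb) (hαc : 0 < αc * δ₀) (hα'1 : α' ≤ 1)
    (hsplit₁ : αst + asep + ρ ≤ aL) (hsplit₂ : αst + ρ ≤ aD) (hsplit₃ : αst + αc + ρ ≤ aL)
    (hκG : κG = A ^ 2 * CG * B6.c1 d₂ ((1 - αG) * δG) α₂)
    (hθ₁ : θ₁ = Nn * (((M₂ * ∑ j, ‖b j‖) ^ 2 * κG) * B₀ * C * B6.c1 d' δ₀ (bb - ρ) * Real.exp (-(asep * δ₀ * Dsep))))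
    (hθ₂ : θ₂ = Nn * (κD * Real.exp (-(2 * δ₀ * Dsep)) * B₀ * C * B6.c1 d' δ₀ (bb - ρ)))
    (hθ₃ : θ₃ = Nn * ((ℓ₀ + ℓ₁ * (αc * δ₀)⁻¹) * ((M₂ * ∑ j, ‖b j‖) ^ 2 * κG) * B₀ * C * B6.c1 d' δ₀ (bb - ρ)))
    (htri : Triangle254 (toB6 (geo9K i) Rr Hp)) (hrefl : ∀ y : (geo9K i).Site, (geo9K i).dist y y = 0)
    (hsymm : ∀ a a' : (geo9K i).Site, (geo9K i).dist a a' = (geo9K i).dist a' a) (hdnn : ∀ a a' : (geo9K i).Site, 0 ≤ (geo9K i).dist a a')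
    (hST : B9Ineq347.ScaleTransfer (geo9K i) δ₀ αst C (fun a => ((geo9K i).len a ^ 4)⁻¹)) (h261b : Ineq261 d' (toB6 (geo9K i) Rr Hp) δ₀ (bb - ρ))
    (h261 : Ineq261 d' (toB6 (geo9K i) Rr Hp) (ρ * δ₀) α') (h263 : Ineq263 d' (toB6 (geo9K i) Rr Hp) (ρ * δ₀) α')
    (hsmall : (θ₁ + θ₂ + θ₃) * B6.c1 d' (ρ * δ₀) α' < 1)
    (hsq : ∀ t, ∑ k, h k t ^ 2 = 1) (hh : ∀ k t, |h k t| ≤ 1) (hS : ∀ k t, h k t ≠ 0 → ιB t ∈ S k)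
    (hcnt : ∀ a : (geo9K i).Site, (∑ k, if a ∈ S k then (1 : ℝ) else 0) ≤ Nn)
    (hχ01 : ∀ k t, 0 ≤ χ k t ∧ χ k t ≤ 1) (hχS : ∀ k t, ιB t ∈ Sχ k → χ k t = 1)
    (hsep : ∀ k a, a ∉ Sχ k → ∀ a'' ∈ S k, Dsep ≤ (geo9K i).dist a a'')
    (hLip : ∀ k (t t' : BlkY i), |h k t' - h k t| ≤ ℓ₀ + ℓ₁ * (geo9K i).dist (ιB t) (ιB t'))
    (hloc : ∀ k, (cutMulY (𝔸 := Matrix (Fin N) (Fin N) ℂ) (h k)).restrictScalars ℝ *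
      ((cutMulY (𝔸 := Matrix (Fin N) (Fin N) ℂ) (χ k)).restrictScalars ℝ * (XY i (parKnitY i) (Oc k) U).restrictScalars ℝ) * Cl k *
        (cutMulY (𝔸 := Matrix (Fin N) (Fin N) ℂ) (h k)).restrictScalars ℝ =
      (cutMulY (𝔸 := Matrix (Fin N) (Fin N) ℂ) (h k)).restrictScalars ℝ * (cutMulY (𝔸 := Matrix (Fin N) (Fin N) ℂ) (h k)).restrictScalars ℝ)
    (hC : ∀ k, HasMajorant (g := toB6 (geo9K i) Rr Hp) (fun p : BlkY i × ι => ιB p.1) (conj b (s • Cl k))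
      (fun a a' => if a ∈ S k then B₀ * ((geo9K i).len a ^ 4)⁻¹ * Real.exp (-(bb * δ₀ * (geo9K i).dist a a')) else 0))
    (hD : ∀ k, HasMajorant (g := toB6 (geo9K i) Rr Hp) (fun p : BlkY i × ι => ιB p.1)
      (conj b ((etaS i ^ 2 * etaS i ^ 2) • ((XY i (parKnitY i) (GpY i (parKnitY i)) U).restrictScalars ℝ - (XY i (parKnitY i) (Oc k) U).restrictScalars ℝ)))
      (fun a a'' => κD * Real.exp (-(2 * δ₀ * Dsep)) * (geo9K i).len a ^ 4 * Real.exp (-(aD * δ₀ * (geo9K i).dist a a''))))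
    -- the word of (3.49): rates, (2.61) at `(ε₀, β)`, row sum at `ρ₃`
    (hrateG : (1 - α') * (ρ * δ₀) ≤ δG) (d₃ : ℕ) {ε₀ βx ρ₃ c₃ : ℝ} (hρ₃ : 0 ≤ ρ₃) (hβ : 0 ≤ βx) (hε₀ : 0 ≤ ε₀)
    (hr₃ : ρ₃ + βx * ε₀ ≤ (1 - α') * (ρ * δ₀)) (h261₃ : Ineq261 d₃ (toB6 (geo9K i) Rr Hp) ε₀ βx)
    (hrow : ∀ a : (geo9K i).Site, ∑ a' : (geo9K i).Site, Real.exp (-(ρ₃ * (geo9K i).dist a a')) ≤ c₃)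
    {η' : ℝ} (hη : η' ≠ 0) (Λf : SiteY i → Matrix (Fin N) (Fin N) ℂ) {r : ℝ} (hΛf : ∀ w, ((((ℓ + 1 : ℕ) : ℝ)) ^ n * η') ^ 2 * ‖Λf w‖ ≤ r)
    (z : SiteY i) :
    ((((ℓ + 1 : ℕ) : ℝ)) ^ n * η') ^ 2 * ‖RY i (parKnitY i) (GpY i (parKnitY i)) U Λf z‖
      ≤ (1 + (∑ j, ‖b j‖) * (((M₂ * ∑ j, ‖b j‖) ^ 2 * A
            * (Nn * B₀ * B6.c1 d' (ρ * δ₀) α' * (1 - (θ₁ + θ₂ + θ₃) * B6.c1 d' (ρ * δ₀) α')⁻¹) * A * B6.c1 d₃ ε₀ βx ^ 2) * c₃ * M₂)) * r := by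
  -- §2: the (3.48)-shape majorant of `s·C(U; parKnitY)` at rate `(1−α′)ρδ₀`
  have hCm := hasMajorant_conj_XinvY_parKnitY_of_site i b ιB hG hU hpar Oc hM₂ hrepr d' d₂ hA hCG hαGδ hα₂0 hα₂1 hδG hSTG h261G hGm hGc hrate Sχ S χ h Cl hs
    hκD hℓ₀ hℓ₁ hB₀ hC0 hN hδ₀ hasep hρ hρb hαc hα'1 hsplit₁ hsplit₂ hsplit₃ hκG hθ₁ hθ₂ hθ₃ htri hrefl hsymm hdnn hST h261b h261 h263 hsmall hsq hh hS
    hcnt hχ01 hχS hsep hLip hloc hC hD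
  have hK : 0 ≤ Nn * B₀ * B6.c1 d' (ρ * δ₀) α' * (1 - (θ₁ + θ₂ + θ₃) * B6.c1 d' (ρ * δ₀) α')⁻¹ :=
    mul_nonneg (mul_nonneg (mul_nonneg hN hB₀) (c1_nonneg _ _ _)) (inv_nonneg.2 (by linarith))
  -- the (3.42)₁ majorant of `η²G′(U; parKnitY)` at the common rate `(1−α′)ρδ₀`
  have hGm' : HasMajorant (g := toB6 (geo9K i) Rr Hp) (fun p : SiteY i × ι => ιB (blkOf i.D.toDomains p.1))
      (conj b ((etaS i ^ 2) • (GpY i (parKnitY i) U).restrictScalars ℝ))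
      (fun a a' => A * (geo9K i).len a ^ 2 * Real.exp (-((1 - α') * (ρ * δ₀) * (geo9K i).dist a a'))) :=
    hasMajorant_mono (g := toB6 (geo9K i) Rr Hp) _ hGm fun a a' =>
      mul_le_mul_of_nonneg_left (Real.exp_le_exp.mpr (by nlinarith [hdnn a a', mul_le_mul_of_nonneg_right hrateG (hdnn a a')]))
        (mul_nonneg hA (sq_nonneg _))
  exact knit_E15_constLev i b ιB hlev hG hpar hM₂ hrepr d₃ hA hK hρ₃ hβ hε₀ hr₃ hs hdnn htri h261₃ hGm' hCm hrow hη Λf hΛf z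

end Knit

end Literature.MathematicalPhysics.QuantumFieldTheory.Balaban1983to89.B9B8KnitLetterCinvFromM56

end
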